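import Literature.AlgebraicGeometry.Deformation.LiftOfVanishingClass
import Literature.AlgebraicGeometry.Deformation.ObstructionClassWellDefined
import Literature.AlgebraicGeometry.Deformation.GenuineLiftCocycle
import Literature.AlgebraicGeometry.Deformation.AdaptedLifts
import Literature.AlgebraicGeometry.Deformation.VectorBundleLifting
import Literature.AlgebraicGeometry.Modules.TensorUnitors
import HarnessLib

/-!
# The Illusie obstruction class of a finite locally free module across a first-order thickening

Setting: `j : Y ⟶ Z₀` a closed immersion, `i : Z₀ ⟶ Z₁` a first-order thickening of a SEPARATED
scheme `Z₁` whose square-zero ideal `𝓘 = ker(i♯)` is identified with `i_* j_* 𝒪_Y`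
(`eI : i_* j_* 𝒪_Y ≅ 𝓘`; e.g. the step `X_{n+1} ↪ X_{n+2}` of a `p`-adic tower, `Y = X_k`), and a
finite locally free `𝒪_{Z₀}`-module `F`, `E = j^*F`.

* `pointFrameCover i hF` — the canonical framed datum of `F` indexed by the points `x ∈ Z₀`:
  AFFINE opens `U_x ∋ i(x)` of `Z₁` with `i⁻¹U_x` inside a trivialising neighbourhood of `x`, and the
  restricted chosen frames; on a separated `Z₁` the pairwise intersections are affine, so lifted
  transition matrices exist (`pointLifts`).
* `illusieObstruction eI F hF ∈ Ext²_Y(E, E ⊗ 𝒪_Y)` (`obstructionGroup 2 E 𝒪_Y`) — the `Ext`-class of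
  the Čech obstruction cocycle of this datum (`Cech.classOf` of `toLocalFamily κ(c)`,
  `Deformation/DefectCochain.lean`, `Modules/CechTheta.lean`), transported along `E ⊗ 𝒪_Y ≅ E`.
  This is the obstruction `o(F) ∈ H²(𝓔nd F ⊗ 𝓘) = Ext²_Y(E, E ⊗ 𝒪_Y)` of Illusie / The Stacks project
  Tag 08VR to lifting `F` to a finite locally free `𝒪_{Z₁}`-module, in Mathlib's `Ext`.
* `illusieObstruction_eq_of_datum` — it is computed by ANY framed lifting datum by affine opens whose
  base opens cover `Y` (datum independence, `Deformation/ObstructionClassWellDefined.lean`).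
* `illusieObstruction_eq_zero_iff` — **the lifting criterion**: `o(F) = 0 ↔ ∃ F'` finite locally
  free on `Z₁` with `i^*F' ≅ F` (⇒: `Deformation/LiftOfVanishingClass.lean`; ⇐: the genuine datum of
  a lift has zero cocycle, `Deformation/GenuineLiftCocycle.lean`, plus datum independence).

Everything is proved; no named facts.

## References

* L. Illusie, *Complexe cotangent et déformations I*, LNM 239 (1971), IV Prop. 3.1.5. [Illusie1971]
* The Stacks project, Tag 08VR. [StacksProject]
* R. Hartshorne, *Deformation Theory*, GTM 257 (2010), §7, Thm. 7.1. [Hartshorne2010]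
-/

noncomputable section

open CategoryTheory CategoryTheory.Abelian AlgebraicGeometry Opposite TopologicalSpace Limits

namespace Literature.AlgebraicGeometry.Deformation

open Literature.AlgebraicGeometry.Modules Literature.AlgebraicGeometry.Motives

universe u

/-! ### Affine framings of a finite locally free module, indexed by points -/

section AffineFraming

variable {X : Scheme.{u}} {G : X.Modules} (hG : IsFiniteLocallyFree G)

/-- An AFFINE open neighbourhood of `z` inside the chosen trivialising neighbourhood of `G` at `z`.
[folklore] -/
def affineTrivNbhd (z : X) : X.Opens :=
  (Opens.isBasis_iff_nbhd.mp X.isBasis_affineOpens (mem_trivNbhd hG z)).choose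

/-- `affineTrivNbhd z` is affine. [folklore] -/
lemma isAffineOpen_affineTrivNbhd (z : X) : IsAffineOpen (affineTrivNbhd hG z) :=
  (Opens.isBasis_iff_nbhd.mp X.isBasis_affineOpens (mem_trivNbhd hG z)).choose_spec.1

/-- `z ∈ affineTrivNbhd z`. [folklore] -/
lemma mem_affineTrivNbhd (z : X) : z ∈ affineTrivNbhd hG z :=
  (Opens.isBasis_iff_nbhd.mp X.isBasis_affineOpens (mem_trivNbhd hG z)).choose_spec.2.1

/-- `affineTrivNbhd z ≤ trivNbhd z`. [folklore] -/
lemma affineTrivNbhd_le (z : X) : affineTrivNbhd hG z ≤ trivNbhd hG z :=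
  (Opens.isBasis_iff_nbhd.mp X.isBasis_affineOpens (mem_trivNbhd hG z)).choose_spec.2.2

/-- **The canonical affine framing of a finite locally free module**, indexed by the points of `X`:
the chosen frame at `z` restricted to an affine neighbourhood `affineTrivNbhd z ∋ z`.
[cite: Hartshorne1977, II Ex. 5.7 (b)] -/
def affineFraming : Framing G X where
  U := affineTrivNbhd hG
  I z := TrivIndex hG z
  instDecidableEq _ := Classical.typeDecidableEq _
  e z := SheafOfModules.restrictTrivialisation (R := X.ringCatSheaf) (homOfLE (affineTrivNbhd_le hG z))
    (trivFrame hG z)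

/-- The opens of the canonical affine framing are affine. [folklore] -/
lemma isAffineOpen_affineFraming_U (z : X) : IsAffineOpen ((affineFraming hG).U z) :=
  isAffineOpen_affineTrivNbhd hG z

/-- `z ∈ U_z` for the canonical affine framing. [folklore] -/
lemma mem_affineFraming_U (z : X) : z ∈ (affineFraming hG).U z :=
  mem_affineTrivNbhd hG z

end AffineFraming

/-! ### The canonical framed lifting datum of `F` across `i`, indexed by the points of `Z₀` -/

section PointFrameCover

variable {Z₀ Z₁ : Scheme.{u}} (i : Z₀ ⟶ Z₁) [IsClosedImmersion i] {F : Z₀.Modules}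
  (hF : IsFiniteLocallyFree F)

/-- An affine open `U_x ⊆ Z₁` with `i(x) ∈ U_x` and `i⁻¹U_x` inside the trivialising neighbourhood of
`F` at `x`. [folklore] -/
def affineTrivOpen (x : Z₀) : Z₁.Opens :=
  (exists_isAffineOpen_preimage_le i (mem_trivNbhd hF x)).choose

/-- `affineTrivOpen x` is affine. [folklore] -/
lemma isAffineOpen_affineTrivOpen (x : Z₀) : IsAffineOpen (affineTrivOpen i hF x) :=
  (exists_isAffineOpen_preimage_le i (mem_trivNbhd hF x)).choose_spec.1

/-- `i(x) ∈ affineTrivOpen x`. [folklore] -/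
lemma mem_affineTrivOpen (x : Z₀) : i.base x ∈ affineTrivOpen i hF x :=
  (exists_isAffineOpen_preimage_le i (mem_trivNbhd hF x)).choose_spec.2.1

/-- `i⁻¹(affineTrivOpen x)` lies in the trivialising neighbourhood of `x`. [folklore] -/
lemma preimage_affineTrivOpen_le (x : Z₀) : i ⁻¹ᵁ affineTrivOpen i hF x ≤ trivNbhd hF x :=
  (exists_isAffineOpen_preimage_le i (mem_trivNbhd hF x)).choose_spec.2.2

/-- **The canonical framed datum of `F` across `i`** (indexed by the points of `Z₀`): affine opens
`U_x ∋ i(x)` of `Z₁` and the chosen frames of `F` restricted to `i⁻¹U_x`.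
[cite: Hartshorne2010, §7 (proof of Thm. 7.1)] -/
def pointFrameCover : FrameCover i F Z₀ where
  U := affineTrivOpen i hF
  I x := TrivIndex hF x
  instDecidableEq _ := Classical.typeDecidableEq _
  e x := SheafOfModules.restrictTrivialisation (R := Z₀.ringCatSheaf)
    (homOfLE (preimage_affineTrivOpen_le i hF x)) (trivFrame hF x)

/-- The opens of the canonical datum are affine. [folklore] -/
lemma isAffineOpen_pointFrameCover_U (x : Z₀) : IsAffineOpen ((pointFrameCover i hF).U x) :=
  isAffineOpen_affineTrivOpen i hF x

/-- `i(x) ∈ U_x`. [folklore] -/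
lemma mem_pointFrameCover_U (x : Z₀) : i.base x ∈ (pointFrameCover i hF).U x :=
  mem_affineTrivOpen i hF x

/-- The opens of the canonical datum cover `Z₁` (`i` being surjective). [folklore] -/
lemma exists_mem_pointFrameCover_U [Surjective i] (z : Z₁) : ∃ x, z ∈ (pointFrameCover i hF).U x := by
  obtain ⟨x, rfl⟩ := i.surjective z
  exact ⟨x, mem_pointFrameCover_U i hF x⟩

/-- The base opens `j⁻¹i⁻¹U_x` of the canonical datum cover `Y`, for any `j : Y ⟶ Z₀`. [folklore] -/
lemma iSup_baseFraming_pointFrameCover_U {Y : Scheme.{u}} (j : Y ⟶ Z₀) :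
    iSup ((pointFrameCover i hF).baseFraming j).U = ⊤ :=
  top_unique fun y _ => Opens.mem_iSup.mpr ⟨j.base y, mem_pointFrameCover_U i hF (j.base y)⟩

/-- **Lifted transition matrices for the canonical datum exist on a separated `Z₁`** (the pairwise
intersections of its affine opens are affine, and `i♯` is surjective over affine opens).
[cite: Hartshorne2010, §7 (proof of Thm. 7.1)] -/
def pointLifts [Z₁.IsSeparated] : (pointFrameCover i hF).Lifts :=
  (pointFrameCover i hF).liftsOfIsAffineOpen fun a b =>
    (isAffineOpen_pointFrameCover_U i hF a).inf (isAffineOpen_pointFrameCover_U i hF b)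

end PointFrameCover

/-! ### The obstruction class and the lifting criterion -/

section Obstruction

variable {Y Z₀ Z₁ : Scheme.{u}} {j : Y ⟶ Z₀} {i : Z₀ ⟶ Z₁} [IsFirstOrderThickening i] [Z₁.IsSeparated]
  (eI : (Scheme.Modules.pushforward i).obj ((Scheme.Modules.pushforward j).obj (unitModule Y)) ≅
    idealModule i)

/-- **The Illusie obstruction class** `o(F) ∈ Ext²_Y(j^*F, j^*F ⊗ 𝒪_Y)` of a finite locally free
`𝒪_{Z₀}`-module `F` to lifting across the first-order thickening `i : Z₀ ⟶ Z₁` with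
`ker(i♯) ≅ i_* j_* 𝒪_Y`: the `Ext`-class of the Čech obstruction cocycle of the canonical framed
datum, transported along `j^*F ⊗ 𝒪_Y ≅ j^*F`. [cite: Illusie1971, IV Prop. 3.1.5]
[cite: StacksProject, Tag 08VR] [cite: Hartshorne2010, §7, Thm. 7.1] -/
def illusieObstruction (F : Z₀.Modules) (hF : IsFiniteLocallyFree F) :
    obstructionGroup 2 ((Scheme.Modules.pullback j).obj F) (unitModule Y) :=
  (extTensorUnitRightEquiv ((Scheme.Modules.pullback j).obj F) ((Scheme.Modules.pullback j).obj F) 2).symm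
    (Cech.classOf (Cech.exactAugmentation ((pointFrameCover i hF).baseFraming j).U
        ((Scheme.Modules.pullback j).obj F) (iSup_baseFraming_pointFrameCover_U i hF j))
      (((pointFrameCover i hF).baseFraming j).toLocalFamily ((pointLifts i hF).defectCochain eI))
      (FrameCover.Lifts.dFamily_toLocalFamily_defectCochain eI (pointLifts i hF)))

variable {eI}

/-- Unfolding `illusieObstruction` on the `Ext²(E, E)` side. [folklore] -/
lemma extTensorUnitRightEquiv_illusieObstruction (F : Z₀.Modules) (hF : IsFiniteLocallyFree F) :
    extTensorUnitRightEquiv _ _ 2 (illusieObstruction eI F hF) =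
      Cech.classOf (Cech.exactAugmentation ((pointFrameCover i hF).baseFraming j).U
          ((Scheme.Modules.pullback j).obj F) (iSup_baseFraming_pointFrameCover_U i hF j))
        (((pointFrameCover i hF).baseFraming j).toLocalFamily ((pointLifts i hF).defectCochain eI))
        (FrameCover.Lifts.dFamily_toLocalFamily_defectCochain eI (pointLifts i hF)) :=
  AddEquiv.apply_symm_apply _ _

/-- **Datum independence**: the obstruction class is computed by ANY framed lifting datum `(C, L)` of
`F` by affine opens of `Z₁` whose base opens `j⁻¹i⁻¹U_a` cover `Y`.
[cite: Hartshorne2010, §7 (proof of Thm. 7.1)] -/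
theorem illusieObstruction_eq_of_datum (F : Z₀.Modules) (hF : IsFiniteLocallyFree F) {ι : Type u}
    {C : FrameCover i F ι} (L : C.Lifts) (hUaff : ∀ a, IsAffineOpen (C.U a))
    (hcovY : iSup (C.baseFraming j).U = ⊤) :
    illusieObstruction eI F hF =
      (extTensorUnitRightEquiv ((Scheme.Modules.pullback j).obj F) ((Scheme.Modules.pullback j).obj F) 2).symm
        (Cech.classOf (Cech.exactAugmentation (C.baseFraming j).U ((Scheme.Modules.pullback j).obj F) hcovY)
          ((C.baseFraming j).toLocalFamily (L.defectCochain eI))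
          (FrameCover.Lifts.dFamily_toLocalFamily_defectCochain eI L)) := by
  have key := FrameCover.Lifts.classOf_obstruction_eq L (pointLifts i hF) eI hcovY
    (iSup_baseFraming_pointFrameCover_U i hF j)
    (fun p => (hUaff p.1).inf (isAffineOpen_pointFrameCover_U i hF p.2))
    (FrameCover.Lifts.dFamily_toLocalFamily_defectCochain eI L)
    (FrameCover.Lifts.dFamily_toLocalFamily_defectCochain eI (pointLifts i hF))
  unfold illusieObstruction
  rw [key]

/-- The same on the `Ext²(E, E)` side. [cite: Hartshorne2010, §7 (proof of Thm. 7.1)] -/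
theorem extTensorUnitRightEquiv_illusieObstruction_eq_classOf (F : Z₀.Modules) (hF : IsFiniteLocallyFree F)
    {ι : Type u} {C : FrameCover i F ι} (L : C.Lifts) (hUaff : ∀ a, IsAffineOpen (C.U a))
    (hcovY : iSup (C.baseFraming j).U = ⊤) :
    extTensorUnitRightEquiv _ _ 2 (illusieObstruction eI F hF) =
      Cech.classOf (Cech.exactAugmentation (C.baseFraming j).U ((Scheme.Modules.pullback j).obj F) hcovY)
        ((C.baseFraming j).toLocalFamily (L.defectCochain eI))
        (FrameCover.Lifts.dFamily_toLocalFamily_defectCochain eI L) := by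
  rw [illusieObstruction_eq_of_datum F hF L hUaff hcovY, AddEquiv.apply_symm_apply]

/-- **Vanishing obstruction ⇒ lift** (The Stacks project Tag 08VR (1), "only if").
[cite: StacksProject, Tag 08VR] [cite: Hartshorne2010, §7, Thm. 7.1] -/
theorem exists_lift_of_illusieObstruction_eq_zero [IsClosedImmersion j] (F : Z₀.Modules)
    (hF : IsFiniteLocallyFree F) (h : illusieObstruction eI F hF = 0) :
    ∃ F' : Z₁.Modules, IsFiniteLocallyFree F' ∧ Nonempty ((Scheme.Modules.pullback i).obj F' ≅ F) := by
  have h0 := extTensorUnitRightEquiv_illusieObstruction (eI := eI) F hF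
  rw [h, map_zero] at h0
  exact (pointLifts i hF).exists_lift_of_classOf_eq_zero eI (isAffineOpen_pointFrameCover_U i hF)
    (fun x => i.base x) (mem_pointFrameCover_U i hF) (fun y => ⟨j.base y, rfl⟩) (hF.pullback j)
    (iSup_baseFraming_pointFrameCover_U i hF j) h0.symm (exists_mem_pointFrameCover_U i hF)

/-- **Lift ⇒ vanishing obstruction** (The Stacks project Tag 08VR (1), "if"): the genuine datum of a
finite locally free lift `F'` (frames of `F'` over affine opens, its own transition matrices as
lifts) has zero obstruction cocycle, and the class does not depend on the datum.
[cite: StacksProject, Tag 08VR] [cite: Hartshorne2010, §7, Thm. 7.1] -/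
theorem illusieObstruction_eq_zero_of_lift (F : Z₀.Modules) (hF : IsFiniteLocallyFree F)
    (F' : Z₁.Modules) (hF' : IsFiniteLocallyFree F') (φ : (Scheme.Modules.pullback i).obj F' ≅ F) :
    illusieObstruction eI F hF = 0 := by
  have hcovY : iSup ((FrameCover.ofFraming (i := i) (affineFraming hF') φ).baseFraming j).U = ⊤ :=
    top_unique fun y _ => Opens.mem_iSup.mpr ⟨i.base (j.base y), mem_affineFraming_U hF' _⟩
  rw [illusieObstruction_eq_of_datum F hF (FrameCover.Lifts.ofFraming (i := i) (affineFraming hF') φ)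
    (isAffineOpen_affineFraming_U hF') hcovY, AddEquiv.map_eq_zero_iff]
  rw [Cech.classOf_congr _ (FrameCover.Lifts.toLocalFamily_defectCochain_ofFraming (affineFraming hF') φ eI)
    _ (by rw [← FrameCover.Lifts.toLocalFamily_defectCochain_ofFraming (affineFraming hF') φ eI]
          exact FrameCover.Lifts.dFamily_toLocalFamily_defectCochain eI _)]
  exact Cech.classOf_zero _ _

/-- **The lifting criterion** (Illusie; The Stacks project Tag 08VR (1)): a finite locally free
`𝒪_{Z₀}`-module `F` is the restriction of a finite locally free `𝒪_{Z₁}`-module iff its obstruction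
class `o(F) ∈ Ext²_Y(j^*F, j^*F ⊗ 𝒪_Y)` vanishes. [cite: Illusie1971, IV Prop. 3.1.5]
[cite: StacksProject, Tag 08VR] [cite: Hartshorne2010, §7, Thm. 7.1] -/
theorem illusieObstruction_eq_zero_iff [IsClosedImmersion j] (F : Z₀.Modules) (hF : IsFiniteLocallyFree F) :
    illusieObstruction eI F hF = 0 ↔
      ∃ F' : Z₁.Modules, IsFiniteLocallyFree F' ∧ Nonempty ((Scheme.Modules.pullback i).obj F' ≅ F) :=
  ⟨exists_lift_of_illusieObstruction_eq_zero F hF, fun ⟨F', hF', ⟨φ⟩⟩ =>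
    illusieObstruction_eq_zero_of_lift F hF F' hF' φ⟩

end Obstruction

end Literature.AlgebraicGeometry.Deformation

end
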